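import Literature.AlgebraicGeometry.Motives.PeriodComparison
import Literature.AlgebraicGeometry.Motives.SummitCompatible
import Literature.AlgebraicGeometry.Motives.BettiHodgeClassicalPin
import Literature.AlgebraicGeometry.Motives.BaseChangeProofs
import Literature.AlgebraicGeometry.HodgeTheory.HodgeConjectureQbarVoisinProofs
import Summits.HodgeConjecture.HodgeConjecture.Theses.PadicSemiregularLift

/-!
# `GrothendieckExistenceDescent` (stmt-HodgeConjecture-1814) · P3 of route `PadicSemiregularLift`:
# algebraization ⇒ algebraic de Rham class, descent to `ℂ` at one embedding, `ℚ`-structure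

Support item P3 ("ALGEBRAIZATION AND DESCENT BOOKKEEPING") of route
`HodgeConjecture/PadicSemiregularLift` is filed INFORMALLY (no Lean signature in the route file).
This file TYPES its three clauses over the tree's real vocabulary and PROVES them, sorry-free, from
the fields of the hypothesis structures the route already argues against
(`Motives.CrystallineRealization` — Berthelot–Ogus comparison `bo`, crystalline / de Rham Chern
characters `chCris` / `chDR`; `Motives.PeriodRealization` — Grothendieck's de Rham–Betti comparison
`iso τ` along an embedding `τ : K →+* ℂ`, `iso_cycleClass`; `Motives.BettiHodgeData` with the
clean-cone summit guard `IsComparisonCompatible`), at the level of VECTOR BUNDLES (the tree has no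
perfect complexes; the whole route — `LiftsFormally`, `LiftsTo`, `FormalVectorBundlesAlgebraize` — is
phrased for vector bundles):

* **(a) algebraization ⇒ algebraic de Rham class** (`bo_chCris_mem_ratAlgebraicClasses_of_liftsTo`,
  `…_mem_algebraicClasses_of_liftsTo`, `…_of_liftsFormally`): if `E₁` on the special fibre `X_k` of a
  smooth proper model `𝒳/W(k)` is the restriction of a vector bundle `E` on `𝒳`
  (`WittScheme.LiftsTo` — for a FORMAL lift this is Grothendieck existence, the route's typed item
  `FormalVectorBundlesAlgebraize` = P3a, taken as a hypothesis in the `_of_liftsFormally` form), then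
  `Φ⁻¹ chᵣ^cris(E₁) = bo (chᵣ^cris(E|X_k)) = chᵣ^dR(E|X_K)` is the class of an algebraic cycle with
  `ℚ`-coefficients on the generic fibre `X_K` (Berthelot–Ogus 1983, Cor. 3.7 / Rem. 3.7.1: `bo`
  matches Chern characters; Grothendieck 1958: `ch^dR` of a bundle is algebraic) — the step that is
  "OPEN for classes and FREE for objects" (Bloch–Esnault–Kerz 2014, p. 3).
* **(b) descent to `ℂ` at ONE embedding** (`iso_tmul_mem_baseChange_algebraicClasses`):
  for `X/K` smooth projective, `τ : K →+* ℂ` and `α` in the `K`-span of the de Rham classes of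
  algebraic cycles on `X`, the comparison `iso τ` carries `1 ⊗ α` into the `ℂ`-span of the Betti
  classes of algebraic cycles on `X_τ = X ⊗_{K,τ} ℂ` (cycle classes commute with base change —
  `PreWeilCohomology.comap_algebraicLattice_le` — and with the comparison up to `(2πi)ᵖ` —
  `iso_cycleClass`, Grothendieck 1966 / Deligne 1982 §1).
* **(c) `ℚ`-structure / summit carriers** (`comparison_mem_algebraicClasses_of_mem_baseChange`):
  for a comparison-compatible Betti datum, the complexified comparison
  `ℂ ⊗_ℚ H²ᵖ_B(Y) → H²ᵖ(Y(ℂ); ℂ)` maps the `ℂ`-span of `1 ⊗ (ℚ · Aᵖ_B(Y))` into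
  `HodgeTheory.algebraicClasses Y p = Nᵖ H²ᵖ(Y(ℂ); ℂ)`, the carrier of the summit statement; the
  rational-descent equality `(V_ℚ ⊗ ℂ) ∩ H²ᵖ(Y, ℚ) = V_ℚ` of the informal text is ALREADY in the
  tree (`HodgeTheory.ringChange_mem_span_image_iff`,
  `BettiHodgeData.toComplexBetti_mem_span_image_iff`, `IsComparisonCompatible.toComplexBetti_mem_algebraicClasses_iff`)
  and is recorded here in the `B`-setting as `comparison_one_tmul_mem_algebraicClasses_iff`.
* **The chain** (`grothendieckExistenceDescent`, `grothendieckExistenceDescent_of_liftsFormally`,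
  and `grothendieckExistenceDescent_of_iso` for a complex `Y` with a descent datum `e : Y ≅ (X_K)_τ`):
  (a) ∘ (b) ∘ (c) for a crystalline realization `C` and a period realization `P` over `K = W(k)[1/p]`
  sharing their de Rham realization (`P.dR = C.dR`): for every vector bundle `E₁` on `X_k` that lifts
  to `𝒳` (resp. lifts formally, under P3a), every `τ : K →+* ℂ` and every `r`, the complex class of
  `Φ⁻¹ chᵣ^cris(E₁)` on `(X_K)_τ(ℂ)` lies in `HodgeTheory.algebraicClasses ((X_K)_τ) r`.

PROPOSED SIGNATURE for the planner (the item has none): the statement of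
`grothendieckExistenceDescent_of_liftsFormally` with `FormalVectorBundlesAlgebraize` discharged, i.e.
the statement of `grothendieckExistenceDescent` (closed over all its binders).

Not here: the CHOICE of `τ` extending a given embedding of the field of definition (pure field
theory; every `τ` is covered), perfect complexes (no carrier), Riemann–Roch (not needed: `ℚ`-coefficients).

References: [BerthelotOgus1983] Cor. 3.7, Rem. 3.7.1; [BlochEsnaultKerz2014pAdic] §1 p. 3, Thm. 1.3;
[Grothendieck1966] Thm. 1'; [Deligne1982] §1; [Deligne2000] §1, §2 (ii), (vi); [VoisinHodgeI2002] §7.1.1,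
§11.3; [GortzWedhorn2023] Thm. 24.94 / Prop. 24.95 (= EGA III₁ 5.1.4).
-/

-- `Summit.HodgeConjecture.HodgeConjecture.…` repeats the summit name by the D-0017 layout (Sub = Summit).
set_option linter.dupNamespace false

noncomputable section

open CategoryTheory AlgebraicGeometry
open scoped TensorProduct Isocrystal
open Literature.AlgebraicGeometry Literature.AlgebraicGeometry.Motives
open Literature.AlgebraicGeometry.Motives.WittScheme
open Literature.AlgebraicTopology.SingularHomology

namespace Summit.HodgeConjecture.HodgeConjecture.Theorems.GrothendieckExistenceDescent

/-! ## (a) Algebraization ⇒ `Φ⁻¹ ch^cris(E₁)` is an algebraic de Rham class on `X_K` -/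

section Algebraization

variable {p : ℕ} [Fact p.Prime] {k : Type} [Field k] [CharP k p] [PerfectRing k p]
  (C : CrystallineRealization p k) {n : ℕ} {𝒳 : SchemeOver (WittVector p k)}

/-- **(a), `ℚ`-cycle form.** If `E₁` on the special fibre of a smooth proper model `𝒳/W(k)` is the
restriction of a vector bundle `E` on `𝒳` (`LiftsTo 𝒳 E₁`), then
`Φ⁻¹ chᵣ^cris(E₁) = bo (chᵣ^cris(E|X_k)) = chᵣ^dR(E|X_K)` (Berthelot–Ogus 1983, Cor. 3.7, Rem. 3.7.1;
field `bo_chCris`) is the de Rham class of an algebraic cycle with `ℚ`-coefficients on the generic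
fibre `X_K` (Grothendieck 1958: `ch` is a rational polynomial in Chern classes of cycles; field
`chDR_mem_ratAlgebraicClasses`). This is the content of "algebraization is FREE for objects"
(Bloch–Esnault–Kerz 2014, p. 3) once the object is algebraized.
[cite: BerthelotOgus1983, Cor. 3.7 and Rem. 3.7.1] [cite: BlochEsnaultKerz2014pAdic, §1 Thm. 1.3] -/
theorem bo_chCris_mem_ratAlgebraicClasses_of_liftsTo (h𝒳 : IsSmoothProperModel n 𝒳)
    {E₁ : (specialFibre 𝒳).left.Modules} (hE₁ : LiftsTo 𝒳 E₁) (r : ℕ) :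
    C.bo 𝒳 (2 * r) (C.chCris (specialFibre 𝒳) E₁ r) ∈
      C.dR.ratAlgebraicClasses (genericFibre 𝒳) r := by
  obtain ⟨E, hE, ⟨e⟩⟩ := hE₁
  rw [← C.chCris_congr e r, C.bo_chCris h𝒳 E hE r]
  exact C.chDR_mem_ratAlgebraicClasses h𝒳.isSmoothProjective_genericFibre _ r

/-- **(a), `K`-span form.** Under `LiftsTo 𝒳 E₁`, `Φ⁻¹ chᵣ^cris(E₁)` lies in the `K`-span
`K · Aʳ_dR(X_K)` of the de Rham classes of the codimension-`r` algebraic cycles of the generic fibre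
(`ratAlgebraicClasses ≤ algebraicClasses` in characteristic `0`).
[cite: BerthelotOgus1983, Cor. 3.7 and Rem. 3.7.1] [cite: Deligne2000, §2 (ii)] -/
theorem bo_chCris_mem_algebraicClasses_of_liftsTo (h𝒳 : IsSmoothProperModel n 𝒳)
    {E₁ : (specialFibre 𝒳).left.Modules} (hE₁ : LiftsTo 𝒳 E₁) (r : ℕ) :
    C.bo 𝒳 (2 * r) (C.chCris (specialFibre 𝒳) E₁ r) ∈ C.dR.algebraicClasses (genericFibre 𝒳) r :=
  C.dR.ratAlgebraicClasses_le_algebraicClasses (genericFibre 𝒳) r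
    (bo_chCris_mem_ratAlgebraicClasses_of_liftsTo C h𝒳 hE₁ r)

/-- **(a) from a FORMAL lift, under P3a.** If `E₁` lifts compatibly to all thickenings
`X_n = 𝒳 ⊗ W/pⁿ` (`LiftsFormally`) and formal vector bundles on the smooth proper model algebraize
(the route's typed item `FormalVectorBundlesAlgebraize` = Grothendieck's existence theorem,
EGA III₁ 5.1.4 / Görtz–Wedhorn Prop. 24.95, taken as a hypothesis), then `Φ⁻¹ chᵣ^cris(E₁)` is in the
`K`-span of the de Rham classes of algebraic cycles on `X_K`.
[cite: GortzWedhorn2023, Thm. 24.94 and Prop. 24.95] [cite: BlochEsnaultKerz2014pAdic, §1 p. 3] -/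
theorem bo_chCris_mem_algebraicClasses_of_liftsFormally
    (hP3a : Theses.PadicSemiregularLift.FormalVectorBundlesAlgebraize)
    (h𝒳 : IsSmoothProperModel n 𝒳) {E₁ : (specialFibre 𝒳).left.Modules}
    (hE₁ : LiftsFormally 𝒳 E₁) (r : ℕ) :
    C.bo 𝒳 (2 * r) (C.chCris (specialFibre 𝒳) E₁ r) ∈ C.dR.algebraicClasses (genericFibre 𝒳) r :=
  bo_chCris_mem_algebraicClasses_of_liftsTo C h𝒳 (hP3a p k n 𝒳 h𝒳 E₁ hE₁) r

end Algebraization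

/-! ## (b) Descent to `ℂ` at one embedding: cycle classes vs. base change and the comparison -/

section Descent

/-- In `A ⊗_K V`, `1 ⊗ (c • v) = (algebraMap K A c) • (1 ⊗ v)` (auxiliary). [folklore] -/
theorem one_tmul_smul_eq_algebraMap_smul {K : Type*} [Field K] {A : Type*} [CommRing A] [Algebra K A]
    {V : Type*} [AddCommGroup V] [Module K V] (c : K) (v : V) :
    ((1 : A) ⊗ₜ[K] (c • v) : A ⊗[K] V) = (algebraMap K A c) • ((1 : A) ⊗ₜ[K] v) := by
  rw [TensorProduct.tmul_smul, algebraMap_smul]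

variable {K : Type} [Field K] [CharZero K] (P : PeriodRealization K) (τ : K →+* ℂ)
  {n : ℕ} {X : SchemeOver K}

/-- **(b) Cycle classes commute with base change and with the de Rham–Betti comparison at one
embedding.** For `X` smooth projective over `K`, `τ : K →+* ℂ` and `α ∈ K · Aᵖ_dR(X)` (the `K`-span
of the de Rham classes `cl_dR(Z)` of codimension-`p` cycles on `X`), the comparison
`iso τ : H²ᵖ_dR(X) ⊗_{K,τ} ℂ → H²ᵖ_B(X_τ) ⊗_ℚ ℂ` carries `1 ⊗ α` into the `ℂ`-span of
`1 ⊗ (ℚ · Aᵖ_B(X_τ))`, the base change of the span of the Betti classes of algebraic cycles on the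
COMPLEX variety `X_τ`: on generators `iso (1 ⊗ cl_dR(Z)) = (2πi)ᵖ · (1 ⊗ cl_B(Z_τ))` (field
`iso_cycleClass`; Grothendieck 1966, Deligne 1982 §1) and `cl_B(Z_τ) = ∑ cl_B(Z')` over the
components `Z'` of `Z ⊗_{K,τ} ℂ` is `B`-algebraic on `X_τ` (`PreWeilCohomology.comap_algebraicLattice_le`).
[cite: Deligne1982, §1] [cite: Grothendieck1966, Thm. 1'] -/
theorem iso_tmul_mem_baseChange_algebraicClasses
    (hX : IsSmoothProjective n X) (p : ℕ) {α : P.dR.obj X (2 * p)}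
    (hα : α ∈ P.dR.algebraicClasses X p) :
    P.iso τ X (2 * p) ((1 : AlongHom ℂ τ) ⊗ₜ[K] α) ∈
      (P.B.W.algebraicClasses ((baseChangeHom τ).obj X) p).baseChange (AlongHom ℂ τ) := by
  induction hα using Submodule.span_induction with
  | mem x hx =>
    induction hx using AddSubgroup.closure_induction with
    | mem y hy =>
      obtain ⟨⟨z, hz⟩, rfl⟩ := hy
      rw [P.iso_cycleClass τ hX p z hz]
      refine Submodule.smul_mem _ _ (Submodule.tmul_mem_baseChange_of_mem 1 ?_)
      exact P.B.W.algebraicLattice_le_algebraicClasses _ p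
        (P.B.W.toPreWeilCohomology.comap_algebraicLattice_le τ X p
          ((P.B.comap τ).cycleClass_mem_algebraicLattice X p hz))
    | zero => rw [TensorProduct.tmul_zero, map_zero]; exact zero_mem _
    | add y y' _ _ hy hy' => rw [TensorProduct.tmul_add, map_add]; exact add_mem hy hy'
    | neg y _ hy => rw [TensorProduct.tmul_neg, map_neg]; exact neg_mem hy
  | zero => rw [TensorProduct.tmul_zero, map_zero]; exact zero_mem _
  | add x y _ _ hx hy => rw [TensorProduct.tmul_add, map_add]; exact add_mem hx hy
  | smul c x _ hx => rw [one_tmul_smul_eq_algebraMap_smul, map_smul]; exact Submodule.smul_mem _ _ hx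

end Descent

/-! ## (c) `ℚ`-structure: from `ℂ ⊗_ℚ H_B` to the carriers of the summit statement -/

section RationalStructure

variable {K : Type} [Field K] (τ : K →+* ℂ)

/-- `alongHomTensorEquiv` (forgetting that the left factor `ℂ` is a `K`-algebra along `τ`) is
compatible with the two scalar actions: `(a • x) ↦ a • x` with `a : AlongHom ℂ τ` read in `ℂ`
(auxiliary; on pure tensors both sides are `(a * b) ⊗ v`). [folklore] -/
theorem alongHomTensorEquiv_smul {V : Type*} [AddCommGroup V] [Module ℚ V] (a : AlongHom ℂ τ)
    (x : AlongHom ℂ τ ⊗[ℚ] V) :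
    alongHomTensorEquiv τ V (a • x) = (AlongHom.equiv τ a) • alongHomTensorEquiv τ V x := by
  induction x using TensorProduct.induction_on with
  | zero => rw [smul_zero, map_zero, smul_zero]
  | tmul b v =>
    rw [TensorProduct.smul_tmul', alongHomTensorEquiv_tmul, alongHomTensorEquiv_tmul, smul_eq_mul,
      map_mul, TensorProduct.smul_tmul', smul_eq_mul]
  | add x y hx hy => rw [smul_add, map_add, hx, hy, map_add, smul_add]

variable {B : BettiHodgeData ℂ} {n : ℕ} {Y : SchemeOver ℂ}

/-- **(c) Summit carriers.** For a comparison-compatible Betti–Hodge datum `B`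
(`IsComparisonCompatible`: its complexified algebraic classes span
`HodgeTheory.algebraicClasses = Nᵖ H²ᵖ(Y(ℂ); ℂ)`, Fulton §19.1) and `Y` smooth projective over `ℂ`,
the complexified comparison `B.comparison Y (2p) : ℂ ⊗_ℚ H²ᵖ_B(Y) → H²ᵖ(Y(ℂ); ℂ)`, `c ⊗ t ↦ c • ι(iso t)`,
maps the `ℂ`-span of `1 ⊗ (ℚ · Aᵖ_B(Y))` — read through `alongHomTensorEquiv τ` when the scalars are
`ℂ` as a `K`-algebra along `τ` — into `HodgeTheory.algebraicClasses Y p`.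
[cite: Fulton1998, §19.1 Lemma 19.1.1] [cite: Deligne2000, §1] -/
theorem comparison_mem_algebraicClasses_of_mem_baseChange
    (hB : B.IsComparisonCompatible) (hY : IsSmoothProjective n Y) (p : ℕ)
    {x : AlongHom ℂ τ ⊗[ℚ] B.W.obj Y (2 * p)}
    (hx : x ∈ (B.W.algebraicClasses Y p).baseChange (AlongHom ℂ τ)) :
    B.comparison Y (2 * p) (alongHomTensorEquiv τ (B.W.obj Y (2 * p)) x) ∈
      HodgeTheory.algebraicClasses Y p := by
  rw [Submodule.baseChange_eq_span] at hx
  induction hx using Submodule.span_induction with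
  | mem y hy =>
    obtain ⟨t, ht, rfl⟩ := hy
    rw [TensorProduct.mk_apply, alongHomTensorEquiv_tmul, map_one, B.comparison_tmul, one_smul]
    exact hB.toComplexBetti_mem_algebraicClasses hY p ht
  | zero => rw [map_zero, map_zero]; exact zero_mem _
  | add y y' _ _ hy hy' => rw [map_add, map_add]; exact add_mem hy hy'
  | smul a y _ hy => rw [alongHomTensorEquiv_smul, map_smul]; exact Submodule.smul_mem _ _ hy

/-- **(c) Rational descent, `(V_ℚ ⊗ ℂ) ∩ H²ᵖ(Y, ℚ) = V_ℚ`** in this setting: for a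
comparison-compatible `B`, `Y` smooth projective and a RATIONAL Betti class `t ∈ H²ᵖ_B(Y)`, the complex
class `B.comparison Y (2p) (1 ⊗ t) = ι(iso t)` is algebraic in the summit sense iff `t ∈ ℚ · Aᵖ_B(Y)`
(the tree's `toComplexBetti_mem_algebraicClasses_iff`, i.e. `HodgeTheory.ringChange_mem_span_image_iff`:
a rational class in the `ℂ`-span of rational classes `V` is in `V`; Voisin I, §7.1.1). Hence the
`ℂ`-span reached in (b) loses nothing on rational classes, as the informal item (c) asserts.
[cite: VoisinHodgeI2002, §7.1.1] [cite: Deligne2000, §1] -/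
theorem comparison_one_tmul_mem_algebraicClasses_iff
    (hB : B.IsComparisonCompatible) (hY : IsSmoothProjective n Y) (p : ℕ) (t : B.W.obj Y (2 * p)) :
    B.comparison Y (2 * p) ((1 : ℂ) ⊗ₜ[ℚ] t) ∈ HodgeTheory.algebraicClasses Y p ↔
      t ∈ B.W.algebraicClasses Y p := by
  rw [B.comparison_tmul, one_smul]
  exact hB.toComplexBetti_mem_algebraicClasses_iff hY p t

end RationalStructure

/-! ## The chain (a) ∘ (b) ∘ (c) -/

section Chain

variable {p : ℕ} [Fact p.Prime] {k : Type} [Field k] [CharP k p]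

/-- **P3 = (b) ∘ (c) on the generic fibre**, for ANY algebraic de Rham class: for a period realization
`P` over `K = W(k)[1/p]` with comparison-compatible Betti datum, a smooth proper model `𝒳/W(k)` (so
`X_K` is smooth projective), `τ : K →+* ℂ` and `α ∈ K · Aʳ_dR(X_K)`, the complex class
`comparison (iso τ (1 ⊗ α))` on `(X_K)_τ(ℂ)` lies in `HodgeTheory.algebraicClasses ((X_K)_τ) r`
(`(X_K)_τ` is smooth projective by `IsSmoothProjective.baseChangeHom_holds`).
[cite: Deligne1982, §1] [cite: Deligne2000, §1] -/
theorem comparison_iso_mem_algebraicClasses_of_mem_algebraicClasses (P : PeriodRealization K(p, k))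
    (hPB : P.B.IsComparisonCompatible) {n : ℕ} {𝒳 : SchemeOver (WittVector p k)}
    (h𝒳 : IsSmoothProperModel n 𝒳) (τ : K(p, k) →+* ℂ) (r : ℕ)
    {α : P.dR.obj (genericFibre 𝒳) (2 * r)} (hα : α ∈ P.dR.algebraicClasses (genericFibre 𝒳) r) :
    P.B.comparison ((baseChangeHom τ).obj (genericFibre 𝒳)) (2 * r)
        (alongHomTensorEquiv τ _ (P.iso τ (genericFibre 𝒳) (2 * r) ((1 : AlongHom ℂ τ) ⊗ₜ α))) ∈
      HodgeTheory.algebraicClasses ((baseChangeHom τ).obj (genericFibre 𝒳)) r :=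
  comparison_mem_algebraicClasses_of_mem_baseChange τ hPB
    (IsSmoothProjective.baseChangeHom_holds τ h𝒳.isSmoothProjective_genericFibre) r
    (iso_tmul_mem_baseChange_algebraicClasses P τ h𝒳.isSmoothProjective_genericFibre r hα)

/-- **P3 `GrothendieckExistenceDescent`, typed and proved (object level, `LiftsTo` form).** Let `k` be
perfect of characteristic `p`, `K = W(k)[1/p]`, `C` a crystalline realization over `k` and `P` a period
realization over `K` SHARING its algebraic de Rham realization (`P.dR = C.dR`) whose Betti datum is
comparison-compatible with the summit layer. For a smooth proper model `𝒳/W(k)` of relative dimension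
`n`, a module `E₁` on the special fibre that is the restriction of a vector bundle on `𝒳`
(`LiftsTo` — what Grothendieck existence produces from a formal lift), an embedding `τ : K →+* ℂ` and a
codimension `r`: the complex class on `Y = (X_K)_τ` of `Φ⁻¹ chᵣ^cris(E₁) ∈ H²ʳ_dR(X_K/K)` — transported
by (a) `bo`, (b) Grothendieck's comparison `iso τ`, (c) the complexified Betti comparison — lies in
`HodgeTheory.algebraicClasses Y r`, the `ℂ`-span of the classes of codimension-`r` algebraic cycles on
`Y(ℂ)` (the carrier of `HodgeConjectureFor`). [cite: BlochEsnaultKerz2014pAdic, §1 p. 3 and Thm. 1.3]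
[cite: BerthelotOgus1983, Cor. 3.7 and Rem. 3.7.1] [cite: Deligne1982, §1] [cite: Deligne2000, §2 (ii)] -/
theorem grothendieckExistenceDescent [PerfectRing k p] (C : CrystallineRealization p k)
    (P : PeriodRealization K(p, k))
    (hPC : P.dR = C.dR) (hPB : P.B.IsComparisonCompatible) {n : ℕ}
    {𝒳 : SchemeOver (WittVector p k)} (h𝒳 : IsSmoothProperModel n 𝒳)
    {E₁ : (specialFibre 𝒳).left.Modules} (hE₁ : LiftsTo 𝒳 E₁) (τ : K(p, k) →+* ℂ) (r : ℕ) :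
    P.B.comparison ((baseChangeHom τ).obj (genericFibre 𝒳)) (2 * r)
        (alongHomTensorEquiv τ _ (P.iso τ (genericFibre 𝒳) (2 * r)
          ((1 : AlongHom ℂ τ) ⊗ₜ (hPC ▸ C.bo 𝒳 (2 * r) (C.chCris (specialFibre 𝒳) E₁ r))))) ∈
      HodgeTheory.algebraicClasses ((baseChangeHom τ).obj (genericFibre 𝒳)) r := by
  cases P with
  | mk dR B iso isoInv h₁ h₂ h₃ h₄ h₅ h₆ h₇ h₈ =>
  dsimp only at hPC
  subst hPC
  exact comparison_iso_mem_algebraicClasses_of_mem_algebraicClasses _ hPB h𝒳 τ r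
    (bo_chCris_mem_algebraicClasses_of_liftsTo C h𝒳 hE₁ r)

/-- **P3 from a FORMAL lift, under P3a `FormalVectorBundlesAlgebraize`** (Grothendieck existence for
vector bundles, the route's typed item stmt-HodgeConjecture-14106, taken as a hypothesis): the same
conclusion for every `E₁` that lifts compatibly to all thickenings `𝒳 ⊗ W/pⁿ` (`LiftsFormally` — the
output of the route's P1). This is the form in which the route's assembly consumes P3:
ObjectLift (P1) → Algebraize (P3a) → this theorem. [cite: BlochEsnaultKerz2014pAdic, §1 p. 3]
[cite: GortzWedhorn2023, Thm. 24.94 and Prop. 24.95] [cite: Deligne1982, §1] -/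
theorem grothendieckExistenceDescent_of_liftsFormally [PerfectRing k p]
    (hP3a : Theses.PadicSemiregularLift.FormalVectorBundlesAlgebraize)
    (C : CrystallineRealization p k) (P : PeriodRealization K(p, k))
    (hPC : P.dR = C.dR) (hPB : P.B.IsComparisonCompatible) {n : ℕ}
    {𝒳 : SchemeOver (WittVector p k)} (h𝒳 : IsSmoothProperModel n 𝒳)
    {E₁ : (specialFibre 𝒳).left.Modules} (hE₁ : LiftsFormally 𝒳 E₁) (τ : K(p, k) →+* ℂ) (r : ℕ) :
    P.B.comparison ((baseChangeHom τ).obj (genericFibre 𝒳)) (2 * r)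
        (alongHomTensorEquiv τ _ (P.iso τ (genericFibre 𝒳) (2 * r)
          ((1 : AlongHom ℂ τ) ⊗ₜ (hPC ▸ C.bo 𝒳 (2 * r) (C.chCris (specialFibre 𝒳) E₁ r))))) ∈
      HodgeTheory.algebraicClasses ((baseChangeHom τ).obj (genericFibre 𝒳)) r :=
  grothendieckExistenceDescent C P hPC hPB h𝒳 (hP3a p k n 𝒳 h𝒳 E₁ hE₁) τ r

/-- **P3 for the complex variety itself** (descent datum as an isomorphism). In the route's assembly
the complex variety `Y` is given first and the model is chosen with `Y = X_K ⊗_{K,τ} ℂ`; in the tree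
that identification is an isomorphism `e : Y ≅ (X_K)_τ` of `ℂ`-schemes, and pull-back along an
isomorphism preserves `algebraicClasses = Nʳ H²ʳ` (`HodgeTheory.map_mem_algebraicClasses_of_isOpenImmersion`).
Hence, under the hypotheses of `grothendieckExistenceDescent`, the class of `Φ⁻¹ chᵣ^cris(E₁)` read on
`Y(ℂ)` lies in `HodgeTheory.algebraicClasses Y r`. [cite: Deligne1982, §1] [cite: Deligne2000, §2 (ii)] -/
theorem grothendieckExistenceDescent_of_iso [PerfectRing k p] (C : CrystallineRealization p k)
    (P : PeriodRealization K(p, k)) (hPC : P.dR = C.dR) (hPB : P.B.IsComparisonCompatible) {n : ℕ}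
    {𝒳 : SchemeOver (WittVector p k)} (h𝒳 : IsSmoothProperModel n 𝒳)
    {E₁ : (specialFibre 𝒳).left.Modules} (hE₁ : LiftsTo 𝒳 E₁) (τ : K(p, k) →+* ℂ) (r : ℕ)
    {Y : SchemeOver ℂ} (e : Y ≅ (baseChangeHom τ).obj (genericFibre 𝒳)) :
    HodgeTheory.complexBetti.map e.hom (2 * r)
        (P.B.comparison ((baseChangeHom τ).obj (genericFibre 𝒳)) (2 * r)
          (alongHomTensorEquiv τ _ (P.iso τ (genericFibre 𝒳) (2 * r)
            ((1 : AlongHom ℂ τ) ⊗ₜ (hPC ▸ C.bo 𝒳 (2 * r) (C.chCris (specialFibre 𝒳) E₁ r)))))) ∈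
      HodgeTheory.algebraicClasses Y r :=
  HodgeTheory.map_mem_algebraicClasses_of_isOpenImmersion
    (IsSmoothProjective.baseChangeHom_holds τ h𝒳.isSmoothProjective_genericFibre) e.hom
    (grothendieckExistenceDescent C P hPC hPB h𝒳 hE₁ τ r)

end Chain

end Summit.HodgeConjecture.HodgeConjecture.Theorems.GrothendieckExistenceDescent

end
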